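import Summits.AtomisticToContinuum.BoseEinsteinCondensation.Theorems.BECRieszReverseHolderBoseRieszMembershipGlue
import HarnessLib

/-!
# Route `BECRieszReverseHolder`, crux `CoarseGrainedReverseHolder` (stmt-AtomisticToContinuum-12840),
# line registered (`Lines/registered.lean`): the registered stub `stub_bosecornerOfFieldMoment`

Supports (does not close) stmt-AtomisticToContinuum-12840; stub `stub_bosecornerOfFieldMoment` (S4b)
of the registered line: **extraction of the Bose corner from the classical engine
`RieszShadowFieldMoment`** (route item stmt-AtomisticToContinuum-12841, taken as a hypothesis).

For an admissible pair potential `v` and small density `ρ`, the supremum over `y` of the `θ = 2`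
cavity-field exponential moment `S_n = sup_y ∫_{cell^n} e^{−bH − 2b h_X(y)} / ∫_{cell^n} e^{−bH}` of
the shadow smeared Riesz-2 gas, evaluated along the Bose dictionary
`a = scatteringLength v`, `b = 2π^{-3/2}(a/ρ)^{1/2}`, `η = max((8πρa)^{-1/2}, ρ^{-1/3})`, box side
`L = ((n+1)/ρ)^{1/3}`, is bounded by a constant eventually in `n`.

* Case `a = 0`: `b = 0`, numerator = denominator, `S_n ≤ 1`.
* Case `a > 0`: specialise `RieszShadowFieldMoment` to `θ = 2` at the corner point: the Kac corner
  `(n/L³)η³ ≥ (n/(n+1))·ρξ³ ≥ 1` (`ξ = (8πρa)^{-1/2}`, `ρξ³ ≥ 2` once `ρ ≤ (4(8πa)³)⁻¹`), the coupling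
  corner `b(n/L³)^{2/3} ≤ 2π^{-3/2}a^{1/2}ρ^{1/6} < Γ₀` once `ρ < (Γ₀/(2π^{-3/2}a^{1/2}+1))⁶`, and
  `η ≤ L` eventually (`BoseGas.tendsto_sideLength_atTop`).

The arithmetic is adapted verbatim from
`Summit.AtomisticToContinuum.BoseEinsteinCondensation.Theorems.coarseGrainedReverseHolder_of_fieldMomentDomination`
(Theorems/BECRieszReverseHolderBoseRieszMembershipGlue.lean).
-/

noncomputable section

open MeasureTheory Filter
open scoped ENNReal

namespace Summit.AtomisticToContinuum.BoseEinsteinCondensation.Theorems.CoarseGrainedReverseHolder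

open Literature.MathematicalPhysics.QuantumManyBody
open Summit.AtomisticToContinuum.BoseEinsteinCondensation.Theses.BECRieszReverseHolder

/-- **S4b — extraction of the Bose corner from the engine.** From `RieszShadowFieldMoment`: for
admissible `v` and small `ρ` there is `C` with `S_n ≤ C` eventually in `n` along the Bose dictionary
(`S_n` the supremum over `y` of the `θ = 2` cavity-field exponential moment of the shadow smeared
Riesz-2 gas, box side `L = ((n+1)/ρ)^{1/3}`). Thresholds: `ρ₀ = min ((Γ₀/(K+1))⁶) ((4(8πa)³ + 1)⁻¹)`
with `K = 2π^{-3/2}a^{1/2}`; constant `max C 1`. Case `a = 0`: `b = 0`, `S_n ≤ 1`. Case `a > 0`: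
the item at `θ = 2` in the Kac corner `(n/L³)η³ ≥ 1` and the coupling corner `b(n/L³)^{2/3} ≤ Γ₀`,
with `η ≤ L` eventually. -/
theorem stub_bosecornerOfFieldMoment :
    RieszShadowFieldMoment →
    ∀ v : ℝ → ENNReal, BoseGas.IsRepulsiveFiniteRange v →
    ∃ ρ₀ : ℝ, 0 < ρ₀ ∧ ∀ ρ : ℝ, 0 < ρ → ρ < ρ₀ → ∃ C : ℝ,
    ∀ᶠ n : ℕ in Filter.atTop,
      ∀ (L : ℝ), L = BoseGas.sideLength ρ (n + 1) →
      ∀ (a : ℝ), a = (BoseGas.scatteringLength v).toReal →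
      ∀ (b : ℝ), b = 2 * Real.pi ^ (-(3 / 2 : ℝ)) * (a / ρ) ^ (1 / 2 : ℝ) →
      ∀ (η : ℝ), η = max ((8 * Real.pi * ρ * a) ^ (-(1 / 2 : ℝ))) (ρ ^ (-(1 / 3 : ℝ))) →
      ∀ (g : BoseGas.Space → ℝ), g = (fun x =>
        2 * Real.pi ^ (3 / 2 : ℝ) * ∫ t in Set.Ioi (η ^ 2), t ^ (-(1 / 2 : ℝ)) *
          ((∑' mm : Fin 3 → ℤ, Literature.Analysis.UnboundedOperators.heatKernel t
            (x - BoseGas.latticeVec L mm)) - 1 / L ^ 3)) →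
      ∀ (H : BoseGas.Config n → ℝ), H = (fun X => ∑ i : Fin n, ∑ j : Fin n with i < j, g (X i - X j)) →
      (⨆ y : BoseGas.Space,
        (∫⁻ X in BoseGas.cellN n L,
            ENNReal.ofReal (Real.exp (-(b * H X) - 2 * b * ∑ j : Fin n, g (y - X j)))) /
        (∫⁻ X in BoseGas.cellN n L, ENNReal.ofReal (Real.exp (-(b * H X)))))
        ≤ ENNReal.ofReal C := by
  intro hR v _hv
  obtain ⟨Γ₀, hΓ₀, C, hC⟩ := hR
  -- the scattering length as a real number `a ≥ 0` and the coupling prefactor `K = 2π^{-3/2} a^{1/2}`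
  obtain ⟨a, ha⟩ : ∃ a : ℝ, a = (BoseGas.scatteringLength v).toReal := ⟨_, rfl⟩
  have ha0 : 0 ≤ a := ha ▸ ENNReal.toReal_nonneg
  obtain ⟨K, hK⟩ : ∃ K : ℝ, K = 2 * Real.pi ^ (-(3 / 2 : ℝ)) * a ^ (1 / 2 : ℝ) := ⟨_, rfl⟩
  have hK0 : 0 ≤ K := by rw [hK]; positivity
  -- coupling threshold: below `ρ₁`, `K ρ^{1/6} < Γ₀`
  have hq : 0 < Γ₀ / (K + 1) := div_pos hΓ₀ (by linarith)
  obtain ⟨ρ₁, hρ₁_def⟩ : ∃ ρ₁ : ℝ, ρ₁ = (Γ₀ / (K + 1)) ^ (6 : ℕ) := ⟨_, rfl⟩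
  have hρ₁ : 0 < ρ₁ := hρ₁_def ▸ pow_pos hq 6
  have hsmall : ∀ ρ : ℝ, 0 < ρ → ρ < ρ₁ → K * ρ ^ (1 / 6 : ℝ) < Γ₀ := by
    intro ρ hρ hρlt
    have h1 : ρ ^ (1 / 6 : ℝ) < ρ₁ ^ (1 / 6 : ℝ) :=
      Real.rpow_lt_rpow hρ.le hρlt (by norm_num)
    have h2 : ρ₁ ^ (1 / 6 : ℝ) = Γ₀ / (K + 1) := by
      rw [hρ₁_def, one_div]
      exact Real.pow_rpow_inv_natCast hq.le (by norm_num)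
    have h3 : 0 ≤ ρ ^ (1 / 6 : ℝ) := Real.rpow_nonneg hρ.le _
    calc K * ρ ^ (1 / 6 : ℝ) ≤ (K + 1) * ρ ^ (1 / 6 : ℝ) := by nlinarith
      _ < (K + 1) * (Γ₀ / (K + 1)) := by
          rw [← h2]; exact mul_lt_mul_of_pos_left h1 (by linarith)
      _ = Γ₀ := by field_simp
  -- Kac threshold: below `ρ₂`, `ρ ξ³ ≥ 2` for the healing length `ξ = (8πρa)^{-1/2}` (only used if `a > 0`)
  obtain ⟨ρ₂, hρ₂_def⟩ : ∃ ρ₂ : ℝ, ρ₂ = (4 * (8 * Real.pi * a) ^ 3 + 1)⁻¹ := ⟨_, rfl⟩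
  have hρ₂ : 0 < ρ₂ := by rw [hρ₂_def]; positivity
  refine ⟨min ρ₁ ρ₂, lt_min hρ₁ hρ₂, fun ρ hρ hρlt => ⟨max C 1, ?_⟩⟩
  have hρ₁' : ρ < ρ₁ := hρlt.trans_le (min_le_left _ _)
  have hρ₂' : ρ < ρ₂ := hρlt.trans_le (min_le_right _ _)
  -- the smearing length of the dictionary is positive, hence eventually below the side length
  have hη0 : 0 < max ((8 * Real.pi * ρ * a) ^ (-(1 / 2 : ℝ))) (ρ ^ (-(1 / 3 : ℝ))) :=
    lt_max_of_lt_right (Real.rpow_pos_of_pos hρ _)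
  have hL_ev : ∀ᶠ n : ℕ in atTop,
      max ((8 * Real.pi * ρ * a) ^ (-(1 / 2 : ℝ))) (ρ ^ (-(1 / 3 : ℝ))) ≤
        BoseGas.sideLength ρ (n + 1) :=
    ((BoseGas.tendsto_sideLength_atTop hρ).comp (tendsto_add_atTop_nat 1)).eventually_ge_atTop _
  filter_upwards [hL_ev, eventually_ge_atTop 1] with n hLn hn1
  -- the dictionary at this `n`: `L`, `a`, `b`, `η`, the kernel `g` and the Hamiltonian `H`
  intro L hL a' ha' b hb η hη g hg H hH
  subst ha'
  rw [← ha] at hb hη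
  have hL3 : L ^ 3 = ((n : ℝ) + 1) / ρ := by
    rw [hL, BoseGas.sideLength_pow_three hρ, Nat.cast_add_one]
  have hη0' : 0 < η := hη ▸ hη0
  have hLn' : η ≤ L := by rw [hη, hL]; exact hLn
  have hL0 : 0 < L := hη0'.trans_le hLn'
  have hb0 : 0 ≤ b := by rw [hb]; positivity
  -- bound the supremum of the shadow's field moment by `max C 1`, pointwise in `y`
  refine iSup_le fun y => ?_
  rcases ha0.eq_or_lt with ha_zero | ha_pos
  · -- `a = 0`: no coupling, numerator = denominator
    have hb_zero : b = 0 := by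
      rw [hb, ← ha_zero, zero_div, Real.zero_rpow (by norm_num)]; ring
    simp only [hb_zero, zero_mul, mul_zero, neg_zero, sub_zero]
    exact ENNReal.div_self_le_one.trans (by simp)
  · -- `a > 0`: the classical engine in the Kac / weak-coupling corner
    have hb_pos : 0 < b := by rw [hb]; positivity
    have hn1' : (1 : ℝ) ≤ n := by exact_mod_cast hn1
    have hcorner : (1 : ℝ) ≤ (n : ℝ) / L ^ 3 * η ^ 3 := by
      -- `u = 8πρa`, `ξ = u^{-1/2}`, `ρ ξ³ ≥ 2` because `4u³ ≤ ρ²`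
      set u : ℝ := 8 * Real.pi * ρ * a with hu_def
      have hu : 0 < u := by positivity
      have hξη : u ^ (-(1 / 2 : ℝ)) ≤ η := hη ▸ le_max_left _ _
      have hξ3 : (u ^ (-(1 / 2 : ℝ))) ^ 3 = (u ^ (3 / 2 : ℝ))⁻¹ := by
        rw [← Real.rpow_natCast, ← Real.rpow_mul hu.le, ← Real.rpow_neg hu.le]
        norm_num
      have hu32 : 0 < u ^ (3 / 2 : ℝ) := Real.rpow_pos_of_pos hu _
      have hsq : (2 * u ^ (3 / 2 : ℝ)) ^ 2 ≤ ρ ^ 2 := by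
        have h32 : (u ^ (3 / 2 : ℝ)) ^ 2 = u ^ 3 := by
          rw [← Real.rpow_natCast, ← Real.rpow_mul hu.le]
          norm_num
        have hρu : 4 * (8 * Real.pi * a) ^ 3 * ρ ≤ 1 := by
          have hpos : (0 : ℝ) < 4 * (8 * Real.pi * a) ^ 3 + 1 := by positivity
          have h1 : ρ * (4 * (8 * Real.pi * a) ^ 3 + 1) < 1 := by
            calc ρ * (4 * (8 * Real.pi * a) ^ 3 + 1)
                < (4 * (8 * Real.pi * a) ^ 3 + 1)⁻¹ * (4 * (8 * Real.pi * a) ^ 3 + 1) :=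
                  mul_lt_mul_of_pos_right (hρ₂_def ▸ hρ₂') hpos
              _ = 1 := inv_mul_cancel₀ hpos.ne'
          nlinarith
        calc (2 * u ^ (3 / 2 : ℝ)) ^ 2 = 4 * (8 * Real.pi * a) ^ 3 * ρ * ρ ^ 2 := by
              rw [mul_pow, h32, hu_def]; ring
          _ ≤ 1 * ρ ^ 2 := mul_le_mul_of_nonneg_right hρu (by positivity)
          _ = ρ ^ 2 := one_mul _
      have h2u : 2 * u ^ (3 / 2 : ℝ) ≤ ρ :=
        (pow_le_pow_iff_left₀ (by positivity) hρ.le two_ne_zero).1 hsq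
      have hρξ : (2 : ℝ) ≤ ρ * (u ^ (-(1 / 2 : ℝ))) ^ 3 := by
        rw [hξ3, ← div_eq_mul_inv, le_div_iff₀ hu32]
        linarith
      have hη3 : ρ * (u ^ (-(1 / 2 : ℝ))) ^ 3 ≤ ρ * η ^ 3 :=
        mul_le_mul_of_nonneg_left (pow_le_pow_left₀ (by positivity) hξη 3) hρ.le
      rw [hL3]
      calc (1 : ℝ) ≤ n / (n + 1) * (ρ * (u ^ (-(1 / 2 : ℝ))) ^ 3) := by
            have hfr : (1 : ℝ) / 2 ≤ n / (n + 1) := by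
              rw [div_le_div_iff₀ (by norm_num) (by positivity)]; linarith
            nlinarith
        _ ≤ n / (n + 1) * (ρ * η ^ 3) := mul_le_mul_of_nonneg_left hη3 (by positivity)
        _ = n / ((n + 1) / ρ) * η ^ 3 := by field_simp
    have hcoup : b * ((n : ℝ) / L ^ 3) ^ (2 / 3 : ℝ) ≤ Γ₀ := by
      have hfrac : (n : ℝ) / L ^ 3 ≤ ρ := by
        rw [hL3, div_le_iff₀ (by positivity), mul_div_assoc', le_div_iff₀ hρ]
        nlinarith
      have hfrac0 : 0 ≤ (n : ℝ) / L ^ 3 := by positivity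
      calc b * ((n : ℝ) / L ^ 3) ^ (2 / 3 : ℝ) ≤ b * ρ ^ (2 / 3 : ℝ) :=
            mul_le_mul_of_nonneg_left (Real.rpow_le_rpow hfrac0 hfrac (by norm_num)) hb0
        _ = K * ρ ^ (1 / 6 : ℝ) := by
            rw [hb, hK, Real.div_rpow ha0 hρ.le]
            have h16 : ρ ^ (1 / 6 : ℝ) = ρ ^ (2 / 3 : ℝ) / ρ ^ (1 / 2 : ℝ) := by
              rw [← Real.rpow_sub hρ]; norm_num
            rw [h16]
            have hρ12 : 0 < ρ ^ (1 / 2 : ℝ) := Real.rpow_pos_of_pos hρ _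
            field_simp
        _ ≤ Γ₀ := (hsmall ρ hρ hρ₁').le
    have h1 := hC n L b η 2 hL0 hb_pos hη0' hLn' (by norm_num) (by norm_num) hcorner hcoup g hg H hH y
    exact (ENNReal.div_le_of_le_mul h1).trans (ENNReal.ofReal_le_ofReal (le_max_left C 1))

end Summit.AtomisticToContinuum.BoseEinsteinCondensation.Theorems.CoarseGrainedReverseHolder

end
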